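import Summits.CriticalPhenomena.PercolationContinuityZ3.Theorems.Transplant.AutEndStateFC
import Summits.CriticalPhenomena.PercolationContinuityZ3.Theorems.Transplant.AutEndStateCayley
import HarnessLib

/-!
# END-STATE CONTINUITY on CAYLEY GRAPHS of VIRTUALLY FC-SPLIT groups, vFC FORM — `θ(p_c) = 0` on every Cayley graph of every finitely generated group with a
# finite-index subgroup carrying two independent characters and an element of non-trivial character whose CENTRALISER has finite index (not necessarily central)
# — UNCONDITIONAL

builds on p205010 (kernel theorem, internal audit signed; external expert review pending).  Lane `prim-bschramm`, seat `prim-bschramm-p3` gen 32 (DESIGN OWNER;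
RULING L-Q3-2, `P3-NILPOTENT.md` §25; file name and scope by the lead's RULING W-2a: the CENTRAL form with `p_c < 1` and the named product instances
`K × ℤ^d`, `K × ℤ` are gen-1 g7's «AutEndStateFCCayley» — `EndStateCayley.conj4_cayley_of_vb1_central` &c. — and are NOT restated here).  Helper file
(`--supports stmt-CriticalPhenomena-4575 --as helper`).  Def-free.  NOTHING is claimed about the `@[conjecture]` `BenjaminiSchramm1996_conj4_endState`.

THE POINT.  «AutEndStateCayley» (`EndStateCayley.criticalContinuity_of_endState`) showed: END-STATE CONTINUITY ⟹ `θ(p_c) = 0` on every Cayley graph of every group with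
`vb₁ ≥ 2` — conditional on the open end state.  «AutEndStateFC» (`AutCyl.conj4_of_orbitDatum_fc`) proves the end state UNCONDITIONALLY for orbit data with an element
of non-trivial character centralised by a finite-index subgroup.  This file joins them on the part of the `vb₁ ≥ 2` wall where that element exists:
* §1 `exists_input_of_vfc` — `Γ₀ ≤ Γ` of finite index, characters `ψ₀, ψ₁ : Γ₀ → ℤ` independent on `(a, b)`, `z ∈ Γ₀` with `ψ₀ z ≠ 1 ∨ ψ₁ z ≠ 1` commuting with a
  finite-index `N₀ ≤ Γ₀` ⟹ on `Cay(Γ; S)` (ANY finite `S`) the end-state input of «AutEndStateCayley» (`A₀ = L(Γ₀)`, `c = (ψ₀, ψ₁) ∘ L⁻¹`) TOGETHER WITH the transported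
  element `L z` (`c (L z) ≠ 1`) and the transported finite-index subgroup `L(N₀)` commuting with it;
* §2 **`criticalContinuity_of_vfc`** — hence `θ_g(p_c) = 0` at every `g` for every GENERATING `S` (`AutCyl.conj4_of_orbitDatum_fc`): no growth hypothesis, no named fact.
  The central case (`z ∈ Z(Γ₀)`, `N₀ = Γ₀`) with `p_c < 1` in the conclusion and the instances `K × ℤ^d` (`d ≥ 2`, any `K`), `K × ℤ` (`b₁(K) ≥ 1`) are gen-1 g7's
  «AutEndStateFCCayley» (cite `EndStateCayley.conj4_cayley_of_vb1_central`); this file adds the finite-index-centraliser generality (e.g. `z` central in a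
  finite-index subgroup of `Γ₀` only).
WHAT IS NEW AND WHAT IS NOT (lead's located item of 2026-08-27, gen-1 g7): for `Γ₀ = Γ` — i.e. `b₁(Γ) ≥ 2`: `K × ℤ^d` for any `K` and `d ≥ 2`, `K × ℤ` with
`b₁(K) ≥ 1`, every finite generating set — `θ(p_c) = 0` is ALREADY the U_s customers' («SkeletonFrmScaled1CustomersHoldsA»:
`CayleyScaled.criticalContinuity_of_two_characters_holds`, `…criticalContinuity_prod_zTwo_holds`, `…_of_surjective'_holds`; no central element needed there).
The content of this file is new ONLY VIA FINITE INDEX: groups `Γ` with `b₁(Γ) < 2` possible, carrying the two characters and the FC witness on a finite-index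
`Γ₀` (e.g. `(K × ℤ²) ⋊ F`-type extensions whose characters do not extend to `Γ`), `K` of any growth.
[cite: BenjaminiSchramm1996, Conj. 4; §2 (Cayley graphs)] [cite: MartineauSevero2019, Cor. 2.2] [cite: Hutchcroft2016, Thm. 1.1] [cite: GrimmettLi2017Amenability, Prop. 18]
-/

noncomputable section

namespace Summit.CriticalPhenomena.PercolationContinuityZ3.Theorems.Transplant

open SimpleGraph Literature.Barriers.CriticalPhenomena Literature.Probability.LatticeModels Literature.Probability.Percolation
open scoped Classical

namespace EndStateCayley

variable {Γ : Type} [Group Γ]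

/-! ## §1 The end-state input with an FC element, on every Cayley graph -/

/-- **vFC data ⟹ the end-state input WITH an FC element on every Cayley graph of `Γ`**: from `Γ₀ ≤ Γ` of finite index with characters `ψ₀, ψ₁` independent on
`(a, b)`, and `z ∈ Γ₀` with `ψ₀ z ≠ 1 ∨ ψ₁ z ≠ 1` commuting with a finite-index `N₀ ≤ Γ₀`: on `Cay(Γ; S)` the subgroup `A₀ = L(Γ₀)` of left translations
(finitely many orbits, free), the rank-two character `c = (ψ₀, ψ₁) ∘ L⁻¹` killing every (trivial) stabiliser, the element `L z` with `c (L z) ≠ 1`, and the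
finite-index subgroup `L(N₀) ≤ A₀` commuting with it (construction of «AutEndStateCayley» `exists_input_of_vb1`, transported data added).
[cite: BenjaminiSchramm1996, §2 (Cayley graphs)] [cite: GrimmettLi2017Amenability, Prop. 18] -/
theorem exists_input_of_vfc (S : Finset Γ) (Γ₀ : Subgroup Γ) [Γ₀.FiniteIndex] (ψ₀ ψ₁ : Γ₀ →* Multiplicative ℤ) (a b : Γ₀)
    (hind : Multiplicative.toAdd (ψ₀ a) * Multiplicative.toAdd (ψ₁ b) ≠ Multiplicative.toAdd (ψ₁ a) * Multiplicative.toAdd (ψ₀ b))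
    (z : Γ₀) (hz : ψ₀ z ≠ 1 ∨ ψ₁ z ≠ 1) (N₀ : Subgroup Γ₀) [N₀.FiniteIndex] (hN₀ : ∀ n ∈ N₀, n * z = z * n) :
    ∃ (A₀ : Subgroup (mulCayley (↑S : Set Γ) ≃g mulCayley (↑S : Set Γ))) (reps : Finset Γ) (c : A₀ →* Multiplicative (Site 2)),
      (∀ w : Γ, ∃ x : A₀, ∃ s ∈ reps, (x : mulCayley (↑S : Set Γ) ≃g mulCayley (↑S : Set Γ)) s = w) ∧
      (∀ (x : A₀) (w : Γ), (x : mulCayley (↑S : Set Γ) ≃g mulCayley (↑S : Set Γ)) w = w → c x = 1) ∧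
      (∃ x y : A₀, MaxArea.det2 (Multiplicative.toAdd (c x)) (Multiplicative.toAdd (c y)) ≠ 0) ∧
      ∃ (x : A₀) (N : Subgroup A₀), c x ≠ 1 ∧ N.FiniteIndex ∧ ∀ n ∈ N, n * x = x * n := by
  -- left translations as a homomorphism into `Aut(Cay(Γ; S))`
  let L : Γ →* (mulCayley (↑S : Set Γ) ≃g mulCayley (↑S : Set Γ)) :=
    { toFun := leftMulIso S
      map_one' := RelIso.ext fun x => by show (1 : Γ) * x = x; exact one_mul x
      map_mul' := fun g h => RelIso.ext fun x => by show g * h * x = g * (h * x); exact mul_assoc g h x }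
  have hL : ∀ g w : Γ, L g w = g * w := fun g w => rfl
  have hLinj : Function.Injective L := fun g h hgh => by
    have h1 := congrArg (fun e : mulCayley (↑S : Set Γ) ≃g mulCayley (↑S : Set Γ) => e 1) hgh
    simpa only [hL, mul_one] using h1
  set A₀ : Subgroup (mulCayley (↑S : Set Γ) ≃g mulCayley (↑S : Set Γ)) := Γ₀.map L with hA₀
  let e : Γ₀ ≃* A₀ := Γ₀.equivMapOfInjective L hLinj
  have he : ∀ h : Γ₀, ((e h : A₀) : mulCayley (↑S : Set Γ) ≃g mulCayley (↑S : Set Γ)) = L h := fun h =>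
    Subgroup.coe_equivMapOfInjective_apply Γ₀ L hLinj h
  let c : A₀ →* Multiplicative (Site 2) := (CayleyScaled.pairHom ψ₀ ψ₁).comp e.symm.toMonoidHom
  have hc : ∀ h : Γ₀, c (e h) = CayleyScaled.pairHom ψ₀ ψ₁ h := fun h => by
    show CayleyScaled.pairHom ψ₀ ψ₁ (e.symm (e h)) = _; rw [MulEquiv.symm_apply_apply]
  -- right coset representatives: `w = (w ρ(w)⁻¹) ρ(w)` with `w ρ(w)⁻¹ ∈ Γ₀`
  let ρ : Γ → Γ := fun w => ((QuotientGroup.mk (w⁻¹) : Γ ⧸ Γ₀).out)⁻¹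
  have hρ : ∀ w : Γ, w * (ρ w)⁻¹ ∈ Γ₀ := fun w => by
    obtain ⟨k, hk⟩ := QuotientGroup.mk_out_eq_mul Γ₀ w⁻¹
    show w * (((QuotientGroup.mk (w⁻¹) : Γ ⧸ Γ₀).out)⁻¹)⁻¹ ∈ Γ₀
    rw [inv_inv, hk, mul_inv_cancel_left]
    exact k.2
  set reps : Finset Γ := (Set.finite_range fun q : Γ ⧸ Γ₀ => (q.out)⁻¹).toFinset with hreps
  have hρmem : ∀ w, ρ w ∈ reps := fun w => by rw [hreps, Set.Finite.mem_toFinset]; exact ⟨_, rfl⟩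
  refine ⟨A₀, reps, c, fun w => ?_, fun x w hxw => ?_, ?_, ?_⟩
  · refine ⟨e ⟨w * (ρ w)⁻¹, hρ w⟩, ρ w, hρmem w, ?_⟩
    rw [he, hL]
    exact inv_mul_cancel_right w (ρ w)
  · -- the action is free: `x = e γ` with `γ w = w` forces `γ = 1`
    have hx : x = e (e.symm x) := (MulEquiv.apply_symm_apply e x).symm
    have hγ : ((e.symm x : Γ₀) : Γ) = 1 := by
      have h1 : ((e (e.symm x) : A₀) : mulCayley (↑S : Set Γ) ≃g mulCayley (↑S : Set Γ)) w = w := by rw [← hx]; exact hxw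
      rw [he, hL] at h1
      exact mul_eq_right.1 h1
    rw [hx, hc]
    have h1 : (e.symm x : Γ₀) = 1 := Subtype.ext hγ
    rw [h1, map_one]
  · refine ⟨e a, e b, ?_⟩
    rw [hc, hc, MaxArea.det2, CayleyScaled.toAdd_pairHom_zero, CayleyScaled.toAdd_pairHom_one, CayleyScaled.toAdd_pairHom_zero,
      CayleyScaled.toAdd_pairHom_one]
    exact sub_ne_zero.2 hind
  · -- the transported FC element and its finite-index centralising subgroup
    refine ⟨e z, N₀.map (e : Γ₀ →* A₀), ?_, ?_, ?_⟩
    · intro h1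
      rw [hc] at h1
      have h0 : Multiplicative.toAdd (CayleyScaled.pairHom ψ₀ ψ₁ z) = 0 := by rw [h1]; rfl
      have hψ₀ : Multiplicative.toAdd (ψ₀ z) = 0 := by
        rw [← CayleyScaled.toAdd_pairHom_zero ψ₀ ψ₁ z, h0]; rfl
      have hψ₁ : Multiplicative.toAdd (ψ₁ z) = 0 := by
        rw [← CayleyScaled.toAdd_pairHom_one ψ₀ ψ₁ z, h0]; rfl
      rcases hz with h | h
      · exact h (toAdd_eq_zero.1 hψ₀)
      · exact h (toAdd_eq_zero.1 hψ₁)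
    · rw [Subgroup.finiteIndex_iff, Subgroup.index_map_equiv]
      exact Subgroup.FiniteIndex.index_ne_zero
    · intro n hn
      obtain ⟨n₀, hn₀, rfl⟩ := Subgroup.mem_map.1 hn
      change e n₀ * e z = e z * e n₀
      rw [← map_mul, ← map_mul, hN₀ n₀ hn₀]

/-! ## §2 `θ(p_c) = 0` on every Cayley graph of a virtually FC-split group -/

/-- **`θ(p_c) = 0` on EVERY Cayley graph of EVERY finitely generated group with vFC data — UNCONDITIONAL**: `Γ₀ ≤ Γ` of finite index with characters `ψ₀, ψ₁`
independent on a pair `(a, b)`, and `z ∈ Γ₀` with `ψ₀ z ≠ 1 ∨ ψ₁ z ≠ 1` commuting with a finite-index subgroup `N₀ ≤ Γ₀`; `S` any finite generating set; every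
vertex.  Proof: §1 + «AutEndStateFC» `AutCyl.conj4_of_orbitDatum_fc` (covering route; `p_c < 1` automatic).  No growth hypothesis, no named fact.
builds on p205010 (kernel theorem, internal audit signed; external expert review pending). [cite: BenjaminiSchramm1996, Conj. 4; §2 (Cayley graphs)]
[cite: MartineauSevero2019, Cor. 2.2] -/
theorem criticalContinuity_of_vfc (S : Finset Γ) (hS : Subgroup.closure (S : Set Γ) = ⊤) (Γ₀ : Subgroup Γ) [Γ₀.FiniteIndex]
    (ψ₀ ψ₁ : Γ₀ →* Multiplicative ℤ) (a b : Γ₀)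
    (hind : Multiplicative.toAdd (ψ₀ a) * Multiplicative.toAdd (ψ₁ b) ≠ Multiplicative.toAdd (ψ₁ a) * Multiplicative.toAdd (ψ₀ b))
    (z : Γ₀) (hz : ψ₀ z ≠ 1 ∨ ψ₁ z ≠ 1) (N₀ : Subgroup Γ₀) [N₀.FiniteIndex] (hN₀ : ∀ n ∈ N₀, n * z = z * n) (g : Γ) :
    theta (mulCayley (↑S : Set Γ)) g (criticalProbIOf (mulCayley (↑S : Set Γ)) g) = 0 := by
  obtain ⟨A₀, reps, c, h1, h2, h3, x, N, hx, hN, hcomm⟩ := exists_input_of_vfc S Γ₀ ψ₀ ψ₁ a b hind z hz N₀ hN₀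
  haveI : N.FiniteIndex := hN
  exact AutCyl.conj4_of_orbitDatum_fc (mulCayley (↑S : Set Γ)) (CayleyScaled.connected_mulCayley_of_closure S hS) A₀ reps c h1 h2 h3 x hx N hcomm g

end EndStateCayley

end Summit.CriticalPhenomena.PercolationContinuityZ3.Theorems.Transplant

end
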